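import Mathlib
import HarnessLib
import Summits.CriticalPhenomena.PercolationContinuityZ3.Theses.PercLowPointHalfSpace
import Literature.Probability.Percolation.HalfSpaceFloorDilution
import Literature.Probability.Percolation.HalfSpacePinnedPairs

/-!
# Window pair count: stub `stub_pairCount` of line SketchIdeator1 (skeleton floor-russo), crux LowPointBookkeeping

Helper file for the crux skeleton `Cruxes/LowPointBookkeeping/Lines/SketchIdeator1.lean`
(item `stmt-CriticalPhenomena-14713`,
`Summit.CriticalPhenomena.PercolationContinuityZ3.Theses.PercLowPointHalfSpace.LowPointBookkeeping`).
Proves EXACTLY the registered stub signature `stub_pairCount`; no new definition, no measure theory: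
the statement is a deterministic counting inequality, valid for every bond configuration `ω`.

## The statement

Write `ℍ = {x ∈ ℤ³ | 0 ≤ x₀}`, `x ↔ y` for `ω ∈ openConnIn ℍ x y`, `e` for one of the four floor
neighbours `±e₁, ±e₂` of the origin, `W_L = B_L + 2L e₀` for the window (`L ≤ w₀ ≤ 3L`,
`|w_i| ≤ 3L`), `‖v‖ = max_i |v_i|` (sup norm, a natural number),
`m₀(n) = #{y ∈ B_n | 0 ↔ y}`, `m_e(n) = #{y ∈ B_n | e ↔ e + y}` and
`A(r) = {∃ y, ‖y‖ ≥ r ∧ 0 ↔ y} ∩ {∃ y, ‖y - e‖ ≥ r ∧ e ↔ y} ∩ {0 ↮ e}` (two `r`-tall ℍ-disjoint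
ℍ-clusters at the adjacent roots `0, e`; here `‖y‖ ≥ r` means `r ≤ |y_i|` for some `i`). Then
`Σ_{w ∈ W_L} Σ_{v : 1 ≤ v₀} 1[0 ↔ v, e ↔ v + w, 0 ↮ e]`
`≤ Σ_{j < 8L, 2^j < 8L} m₀(2^{j+1}) m_e(20L) 1[A(min(2^j, L))] + Σ_{j : 8L ≤ 2^j} m₀(2^{j+1}) |W_L| 1[A(2^{j-1})]`.

## Proof

Split the points `v` (`v₀ ≥ 1`, so `‖v‖ ≥ 1`) into dyadic classes `j = ⌊log₂ ‖v‖⌋`,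
`2^j ≤ ‖v‖ < 2^{j+1}` (`tsum_eq_single` inserts `Σ_j [j = class v]`, `ENNReal.tsum_comm` swaps).
Fix `j` and a counted pair `(v, w)` of class `j`. Then `v ∈ B_{2^{j+1}}` and `0 ↔ v`, so `v` is
counted by `m₀(2^{j+1})`; the first arm of `A` is witnessed by `y = v` (`|v_i| = ‖v‖ ≥ 2^j` for
some `i`) and `0 ↮ e` is part of the counted event.
* Near classes (`2^j < 8L`): `y = v + w - e ∈ B_{20L}` (`‖y‖ ≤ (16L - 1) + 3L + 1`) with
  `e ↔ e + y = v + w`, and `w ↦ v + w - e` is injective, so for fixed `v` at most `m_e(20L)` window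
  points `w` are counted (`sum_le_ncard`); the second arm at scale `min(2^j, L) ≤ L` is witnessed by
  `y = v + w`, coordinate `0`: `(v + w)₀ - e₀ = v₀ + w₀ ≥ 1 + L`.
* Far classes (`8L ≤ 2^j`, so `j ≥ 1` and `2^{j-1} ≥ 4L`): at most `|W_L|` points `w` per `v`; the
  second arm at scale `2^{j-1}` is witnessed by `y = v + w` at the coordinate `i` with
  `|v_i| = ‖v‖`: `|v_i + w_i - e_i| ≥ 2^j - 3L - 1 ≥ 2^{j-1}`.
In both cases the class-`j` count is `≤ m₀(2^{j+1}) · c_j · 1[A(r_j)]` (`tsum_ite_sum_le`: either the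
two-arm event holds, and one bounds a finitely supported sum, or every term vanishes). Classes with
`2^j < 8L` have `j < 8L`, so the near sum over all `j` is the stated finite sum (`tsum_eq_sum`).
-/

noncomputable section

namespace Summit.CriticalPhenomena.PercolationContinuityZ3.Theorems.FloorRusso

open MeasureTheory Filter Topology
open Literature.Probability.Percolation Literature.Probability.LatticeModels
open scoped ENNReal

/-- The closed half-space `ℍ = {x₀ ≥ 0}` of `ℤ³` (local notation). -/
local notation3 (prettyPrint := false) "ℍ₃" => ({x : Site 3 | 0 ≤ x 0} : Set (Site 3))

/-- The sup norm of a site of `ℤ³`, as a natural number (local notation). -/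
local notation3 (prettyPrint := false) "𝑵⟦" v "⟧" =>
  (Finset.sup Finset.univ fun i : Fin 3 => Int.natAbs (v i))

/-- The window `W_L = B_L + 2L e₀` (local notation). -/
local notation3 (prettyPrint := false) "𝑾⟦" L "⟧" =>
  (Finset.image (fun y : Site 3 => y + Pi.single 0 (((2 * L : ℕ)) : ℤ)) (box 3 L))

/-- The counted event `{0 ↔ v} ∩ {e ↔ v + w} ∩ {0 ↮ e}` (local notation). -/
local notation3 (prettyPrint := false) "𝑬⟦" e ", " v ", " w "⟧" =>
  (openConnIn ℍ₃ 0 v ∩ openConnIn ℍ₃ e (v + w) ∩ (openConnIn ℍ₃ 0 e)ᶜ)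

/-- The two-arm event `A(r)` at the adjacent roots `0, e` (local notation). -/
local notation3 (prettyPrint := false) "𝑨⟦" e ", " r "⟧" =>
  ({ω | ∃ y : Site 3, (∃ i : Fin 3, ((r : ℕ) : ℤ) ≤ |y i|) ∧ ω ∈ openConnIn ℍ₃ 0 y} ∩
    {ω | ∃ y : Site 3, (∃ i : Fin 3, ((r : ℕ) : ℤ) ≤ |y i - e i|) ∧ ω ∈ openConnIn ℍ₃ e y} ∩
      (openConnIn ℍ₃ 0 e)ᶜ)

/-- The set of points of `B_n` joined to `0` in `ℍ` (local notation; `m₀(n)` is its `ncard`). -/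
local notation3 (prettyPrint := false) "𝑪₀⟦" ω ", " n "⟧" =>
  (((↑(box 3 n)) : Set (Site 3)) ∩ {y : Site 3 | ω ∈ openConnIn ℍ₃ 0 y})

/-- The set of offsets `y ∈ B_n` with `e ↔ e + y` in `ℍ` (local notation; `m_e(n)` is its `ncard`). -/
local notation3 (prettyPrint := false) "𝑪⟦" ω ", " e ", " n "⟧" =>
  (((↑(box 3 n)) : Set (Site 3)) ∩ {y : Site 3 | ω ∈ openConnIn ℍ₃ e (e + y)})

namespace PairCount

/-! ## Abstract counting lemmas in `ℝ≥0∞` -/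

/-- A function vanishing off a finite set `A` and bounded by `c` on `A` has sum `≤ |A| c`. -/
theorem tsum_le_ncard_mul {α : Type*} {A : Set α} (hA : A.Finite) {g : α → ℝ≥0∞} {c : ℝ≥0∞}
    (h0 : ∀ a ∉ A, g a = 0) (h1 : ∀ a ∈ A, g a ≤ c) : ∑' a, g a ≤ (A.ncard : ℝ≥0∞) * c := by
  have hs : ∀ a ∉ hA.toFinset, g a = 0 := fun a ha => h0 a (by simpa using ha)
  rw [tsum_eq_sum hs, Set.ncard_eq_toFinset_card A hA]
  calc ∑ a ∈ hA.toFinset, g a ≤ ∑ a ∈ hA.toFinset, c :=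
        Finset.sum_le_sum fun a ha => h1 a (by simpa using ha)
    _ = (hA.toFinset.card : ℝ≥0∞) * c := by rw [Finset.sum_const, nsmul_eq_mul]

/-- A finite sum of terms `≤ 1` is at most `|B|` if the nonzero terms are indexed injectively by
points of the finite set `B`. -/
theorem sum_le_ncard {β γ : Type*} (W : Finset β) (g : β → ℝ≥0∞) {B : Set γ} (hB : B.Finite)
    (φ : β → γ) (hφ : Function.Injective φ) (h1 : ∀ w ∈ W, g w ≤ 1)
    (hB' : ∀ w ∈ W, g w ≠ 0 → φ w ∈ B) : ∑ w ∈ W, g w ≤ (B.ncard : ℝ≥0∞) := by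
  classical
  rw [← Finset.sum_filter_ne_zero W, Set.ncard_eq_toFinset_card B hB]
  calc ∑ w ∈ W.filter (fun w => g w ≠ 0), g w
        ≤ ∑ w ∈ W.filter (fun w => g w ≠ 0), (1 : ℝ≥0∞) :=
        Finset.sum_le_sum fun w hw => h1 w (Finset.mem_filter.1 hw).1
    _ = ((W.filter fun w => g w ≠ 0).card : ℝ≥0∞) := by simp
    _ = (((W.filter fun w => g w ≠ 0).image φ).card : ℝ≥0∞) := by
        rw [Finset.card_image_of_injective _ hφ]
    _ ≤ (hB.toFinset.card : ℝ≥0∞) := by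
        exact_mod_cast Finset.card_le_card fun x hx => by
          obtain ⟨w, hw, rfl⟩ := Finset.mem_image.1 hx
          exact hB.mem_toFinset.2 (hB' w (Finset.mem_filter.1 hw).1 (Finset.mem_filter.1 hw).2)

/-- A finite sum of terms `≤ 1` is at most the number of terms. -/
theorem sum_le_card {β : Type*} (W : Finset β) (g : β → ℝ≥0∞) (h1 : ∀ w ∈ W, g w ≤ 1) :
    ∑ w ∈ W, g w ≤ (W.card : ℝ≥0∞) :=
  (Finset.sum_le_sum h1).trans_eq (by simp)

/-- The class bound: if the nonzero terms `g v w` of class `P` have `v` in the finite set `A`, row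
sums `≤ c`, and force the event `S`, then the class sum is `≤ |A| · c · 1[S]`. -/
theorem tsum_ite_sum_le {α β Ω : Type*} {P : α → Prop} [DecidablePred P] {W : Finset β}
    {g : α → β → ℝ≥0∞} {A : Set α} (hA : A.Finite) {c : ℝ≥0∞} {S : Set Ω} {ω : Ω}
    (ha : ∀ v, P v → ∀ w ∈ W, g v w ≠ 0 → v ∈ A)
    (hb : ∀ v, P v → ∑ w ∈ W, g v w ≤ c)
    (hc : ∀ v, P v → ∀ w ∈ W, g v w ≠ 0 → ω ∈ S) :
    ∑' v, (if P v then ∑ w ∈ W, g v w else 0)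
      ≤ (A.ncard : ℝ≥0∞) * c * S.indicator (fun _ => (1 : ℝ≥0∞)) ω := by
  by_cases hS : ω ∈ S
  · rw [Set.indicator_of_mem hS, mul_one]
    refine tsum_le_ncard_mul hA (fun v hv => ?_) (fun v _ => ?_)
    · split_ifs with hP
      · exact Finset.sum_eq_zero fun w hw => by_contra fun h => hv (ha v hP w hw h)
      · rfl
    · split_ifs with hP
      · exact hb v hP
      · exact zero_le
  · have h0 : ∀ v, (if P v then ∑ w ∈ W, g v w else 0) = 0 := fun v => by
      split_ifs with hP
      · exact Finset.sum_eq_zero fun w hw => by_contra fun h => hS (hc v hP w hw h)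
      · rfl
    simp [h0]

/-! ## Geometry of `ℤ³`: sup norm, dyadic classes, boxes, the window -/

/-- Each coordinate is bounded by the sup norm. -/
theorem natAbs_le_supNorm (v : Site 3) (i : Fin 3) : (v i).natAbs ≤ 𝑵⟦v⟧ :=
  Finset.le_sup (f := fun i : Fin 3 => (v i).natAbs) (Finset.mem_univ i)

/-- The sup norm is attained at some coordinate. -/
theorem exists_natAbs_eq_supNorm (v : Site 3) : ∃ i : Fin 3, (v i).natAbs = 𝑵⟦v⟧ := by
  obtain ⟨i, -, hi⟩ :=
    Finset.exists_mem_eq_sup Finset.univ Finset.univ_nonempty fun i : Fin 3 => (v i).natAbs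
  exact ⟨i, hi.symm⟩

/-- A point of `ℍ₊` has sup norm `≥ 1`. -/
theorem one_le_supNorm {v : Site 3} (hv : 1 ≤ v 0) : 1 ≤ 𝑵⟦v⟧ :=
  le_trans (by omega) (natAbs_le_supNorm v 0)

/-- Sup-norm balls are boxes. -/
theorem mem_box_of_supNorm_le {v : Site 3} {n : ℕ} (h : 𝑵⟦v⟧ ≤ n) : v ∈ box 3 n := by
  rw [mem_box]
  intro i
  have hi := (natAbs_le_supNorm v i).trans h
  omega

/-- A point of dyadic class `j = ⌊log₂ ‖v‖⌋` lies in the box `B_{2^{j+1}}`. -/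
theorem mem_box_succ_log (v : Site 3) : v ∈ box 3 (2 ^ (Nat.log 2 𝑵⟦v⟧ + 1)) :=
  mem_box_of_supNorm_le (Nat.lt_pow_succ_log_self one_lt_two _).le

/-- A point of `ℍ₊` of dyadic class `j` has a coordinate of size `≥ 2^j`. -/
theorem exists_pow_log_le_abs {v : Site 3} (hv : 1 ≤ v 0) :
    ∃ i : Fin 3, ((2 ^ Nat.log 2 𝑵⟦v⟧ : ℕ) : ℤ) ≤ |v i| := by
  obtain ⟨i, hi⟩ := exists_natAbs_eq_supNorm v
  have h : 2 ^ Nat.log 2 𝑵⟦v⟧ ≤ 𝑵⟦v⟧ :=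
    Nat.pow_log_le_self 2 (Nat.one_le_iff_ne_zero.1 (one_le_supNorm hv))
  refine ⟨i, ?_⟩
  rw [← Int.natCast_natAbs]
  exact_mod_cast h.trans_eq hi.symm

/-- Points of the window have height `≥ L` and sup norm `≤ 3L`. -/
theorem window_spec {L : ℕ} {w : Site 3} (hw : w ∈ 𝑾⟦L⟧) :
    (L : ℤ) ≤ w 0 ∧ ∀ i, (w i).natAbs ≤ 3 * L := by
  simp only [Finset.mem_image, mem_box] at hw
  obtain ⟨y, hy, rfl⟩ := hw
  refine ⟨?_, fun i => ?_⟩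
  · have h := (hy 0).1
    simp only [Pi.add_apply, Pi.single_eq_same]
    push_cast
    omega
  · have h := hy i
    by_cases hi : i = 0
    · subst hi
      simp only [Pi.add_apply, Pi.single_eq_same]
      push_cast
      omega
    · simp only [Pi.add_apply, Pi.single_eq_of_ne hi, add_zero]
      omega

/-- Near classes: `v + w - e ∈ B_{20L}` when `2^{class v} < 8L`, `‖w‖ ≤ 3L`, `‖e‖ ≤ 1`. -/
theorem mem_box_near {v w e : Site 3} {L : ℕ} (hj : 2 ^ Nat.log 2 𝑵⟦v⟧ < 8 * L)
    (hw : ∀ i, (w i).natAbs ≤ 3 * L) (he : ∀ i, (e i).natAbs ≤ 1) :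
    v + w - e ∈ box 3 (20 * L) := by
  have hN : 𝑵⟦v⟧ < 2 ^ (Nat.log 2 𝑵⟦v⟧ + 1) := Nat.lt_pow_succ_log_self one_lt_two _
  have hN' : 𝑵⟦v⟧ < 16 * L := by rw [pow_succ] at hN; omega
  rw [mem_box]
  intro i
  have h1 := natAbs_le_supNorm v i
  have h2 := hw i
  have h3 := he i
  simp only [Pi.add_apply, Pi.sub_apply]
  omega

/-! ## The two-arm event on a counted pair -/

/-- Near classes: a counted pair `(v, w)` of class `j` realises `A(min(2^j, L))`. -/
theorem twoArm_near {e v w : Site 3} {L j : ℕ} {ω : BondConfig (Site 3)} (he0 : e 0 = 0)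
    (hv : 1 ≤ v 0) (hw0 : (L : ℤ) ≤ w 0) (hj : j = Nat.log 2 𝑵⟦v⟧) (hE : ω ∈ 𝑬⟦e, v, w⟧) :
    ω ∈ 𝑨⟦e, min (2 ^ j) L⟧ := by
  subst hj
  refine ⟨⟨⟨v, ?_, hE.1.1⟩, ⟨v + w, ⟨0, ?_⟩, hE.1.2⟩⟩, hE.2⟩
  · obtain ⟨i, hi⟩ := exists_pow_log_le_abs hv
    exact ⟨i, le_trans (Nat.cast_le.2 (min_le_left _ _)) hi⟩
  · have h : (L : ℤ) ≤ |(v + w) 0 - e 0| := by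
      rw [Pi.add_apply, he0, sub_zero, abs_of_nonneg (by omega)]
      omega
    exact le_trans (Nat.cast_le.2 (min_le_right _ _)) h

/-- Far classes: a counted pair `(v, w)` of class `j` with `8L ≤ 2^j` realises `A(2^{j-1})`. -/
theorem twoArm_far {e v w : Site 3} {L j : ℕ} {ω : BondConfig (Site 3)}
    (he1 : ∀ i, (e i).natAbs ≤ 1) (hv : 1 ≤ v 0) (hw : ∀ i, (w i).natAbs ≤ 3 * L)
    (hj : j = Nat.log 2 𝑵⟦v⟧) (hfar : 8 * L ≤ 2 ^ j) (hL : 1 ≤ L) (hE : ω ∈ 𝑬⟦e, v, w⟧) :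
    ω ∈ 𝑨⟦e, 2 ^ (j - 1)⟧ := by
  subst hj
  obtain ⟨i, hi⟩ := exists_natAbs_eq_supNorm v
  have hpow : 2 ^ Nat.log 2 𝑵⟦v⟧ ≤ 𝑵⟦v⟧ :=
    Nat.pow_log_le_self 2 (Nat.one_le_iff_ne_zero.1 (one_le_supNorm hv))
  have hk : 2 ^ Nat.log 2 𝑵⟦v⟧ = 2 * 2 ^ (Nat.log 2 𝑵⟦v⟧ - 1) := by
    rcases Nat.eq_zero_or_pos (Nat.log 2 𝑵⟦v⟧) with h | h
    · exfalso
      rw [h] at hfar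
      omega
    · rw [← pow_succ']
      congr 1
      omega
  refine ⟨⟨⟨v, ⟨i, ?_⟩, hE.1.1⟩, ⟨v + w, ⟨i, ?_⟩, hE.1.2⟩⟩, hE.2⟩
  · rw [← Int.natCast_natAbs]
    exact_mod_cast (show 2 ^ (Nat.log 2 𝑵⟦v⟧ - 1) ≤ (v i).natAbs by omega)
  · have h1 := hw i
    have h2 := he1 i
    rw [Pi.add_apply, ← Int.natCast_natAbs]
    exact_mod_cast (show 2 ^ (Nat.log 2 𝑵⟦v⟧ - 1) ≤ (v i + w i - e i).natAbs by omega)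

/-! ## The summand -/

section Summand

variable {e : Site 3} {ω : BondConfig (Site 3)} {g : Site 3 → Site 3 → ℝ≥0∞}

/-- A nonzero term comes from a point of `ℍ₊` and a configuration in the counted event. -/
theorem summand_ne_zero
    (hg : ∀ v w, g v w = if 1 ≤ v 0 then (𝑬⟦e, v, w⟧).indicator (fun _ => (1 : ℝ≥0∞)) ω else 0)
    {v w : Site 3} (h : g v w ≠ 0) : 1 ≤ v 0 ∧ ω ∈ 𝑬⟦e, v, w⟧ := by
  rw [hg] at h
  by_cases hv : 1 ≤ v 0
  · refine ⟨hv, by_contra fun hω => h ?_⟩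
    rw [if_pos hv, Set.indicator_of_notMem hω]
  · exact absurd (if_neg hv) h

/-- The terms are `≤ 1`. -/
theorem summand_le_one
    (hg : ∀ v w, g v w = if 1 ≤ v 0 then (𝑬⟦e, v, w⟧).indicator (fun _ => (1 : ℝ≥0∞)) ω else 0)
    (v w : Site 3) : g v w ≤ 1 := by
  rw [hg]
  split_ifs
  · exact Set.indicator_le_self _ _ _
  · exact zero_le

/-- A point `v` of class `j` with a nonzero term is counted by `m₀(2^{j+1})`. -/
theorem mem_cluster_of_summand_ne_zero
    (hg : ∀ v w, g v w = if 1 ≤ v 0 then (𝑬⟦e, v, w⟧).indicator (fun _ => (1 : ℝ≥0∞)) ω else 0)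
    {j : ℕ} {v w : Site 3} (hj : j = Nat.log 2 𝑵⟦v⟧) (h : g v w ≠ 0) :
    v ∈ 𝑪₀⟦ω, 2 ^ (j + 1)⟧ := by
  subst hj
  exact ⟨Finset.mem_coe.2 (mem_box_succ_log v), (summand_ne_zero hg h).2.1.1⟩

/-- **Near class bound**: for `2^j < 8L` the class-`j` sum is
`≤ m₀(2^{j+1}) · m_e(20L) · 1[A(min(2^j, L))]`. -/
theorem near_class_le (he0 : e 0 = 0) (he1 : ∀ i, (e i).natAbs ≤ 1)
    (hg : ∀ v w, g v w = if 1 ≤ v 0 then (𝑬⟦e, v, w⟧).indicator (fun _ => (1 : ℝ≥0∞)) ω else 0)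
    {L j : ℕ} (hj : 2 ^ j < 8 * L) :
    ∑' v : Site 3, (if j = Nat.log 2 𝑵⟦v⟧ then ∑ w ∈ 𝑾⟦L⟧, g v w else 0)
      ≤ ((𝑪₀⟦ω, 2 ^ (j + 1)⟧).ncard : ℝ≥0∞) * ((𝑪⟦ω, e, 20 * L⟧).ncard : ℝ≥0∞) *
          (𝑨⟦e, min (2 ^ j) L⟧).indicator (fun _ => (1 : ℝ≥0∞)) ω := by
  refine tsum_ite_sum_le ((Finset.finite_toSet _).inter_of_left _)
    (fun v hv w _ h => mem_cluster_of_summand_ne_zero hg hv h) (fun v hv => ?_) (fun v hv w hw h => ?_)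
  · refine sum_le_ncard _ _ ((Finset.finite_toSet _).inter_of_left _) (fun w => v + w - e)
      (fun w₁ w₂ h => by simpa using h) (fun w _ => summand_le_one hg v w) (fun w hw h => ?_)
    obtain ⟨-, hE⟩ := summand_ne_zero hg h
    refine ⟨Finset.mem_coe.2 (mem_box_near (hv ▸ hj) (window_spec hw).2 he1), ?_⟩
    show ω ∈ openConnIn ℍ₃ e (e + (v + w - e))
    rw [add_sub_cancel]
    exact hE.1.2
  · obtain ⟨hv1, hE⟩ := summand_ne_zero hg h
    exact twoArm_near he0 hv1 (window_spec hw).1 hv hE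

/-- **Far class bound**: for `8L ≤ 2^j` (and `L ≥ 1`) the class-`j` sum is
`≤ m₀(2^{j+1}) · |W_L| · 1[A(2^{j-1})]`. -/
theorem far_class_le (he1 : ∀ i, (e i).natAbs ≤ 1)
    (hg : ∀ v w, g v w = if 1 ≤ v 0 then (𝑬⟦e, v, w⟧).indicator (fun _ => (1 : ℝ≥0∞)) ω else 0)
    {L j : ℕ} (hL : 1 ≤ L) (hj : 8 * L ≤ 2 ^ j) :
    ∑' v : Site 3, (if j = Nat.log 2 𝑵⟦v⟧ then ∑ w ∈ 𝑾⟦L⟧, g v w else 0)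
      ≤ ((𝑪₀⟦ω, 2 ^ (j + 1)⟧).ncard : ℝ≥0∞) * ((𝑾⟦L⟧).card : ℝ≥0∞) *
          (𝑨⟦e, 2 ^ (j - 1)⟧).indicator (fun _ => (1 : ℝ≥0∞)) ω := by
  refine tsum_ite_sum_le ((Finset.finite_toSet _).inter_of_left _)
    (fun v hv w _ h => mem_cluster_of_summand_ne_zero hg hv h)
    (fun v _ => sum_le_card _ _ fun w _ => summand_le_one hg v w) (fun v hv w hw h => ?_)
  obtain ⟨hv1, hE⟩ := summand_ne_zero hg h
  exact twoArm_far he1 hv1 (window_spec hw).2 hv hj hL hE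

end Summand

/-- The four floor neighbours of the origin are floor vectors of sup norm `≤ 1`. -/
theorem nbrs_spec {e : Site 3}
    (he : e ∈ ({Pi.single 1 1, Pi.single 1 (-1), Pi.single 2 1, Pi.single 2 (-1)} : Finset (Site 3))) :
    e 0 = 0 ∧ ∀ i, (e i).natAbs ≤ 1 := by
  simp only [Finset.mem_insert, Finset.mem_singleton] at he
  rcases he with rfl | rfl | rfl | rfl <;> refine ⟨by simp, fun i => ?_⟩ <;> fin_cases i <;> simp

end PairCount

open PairCount in
/-- **stub_pairCount (deterministic dyadic bound of the window pair count)**: on every configuration,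
the number of pairs `(v, w) ∈ ℍ₊ × W_L` with `0 ↔_ℍ v`, `e ↔_ℍ v + w`, `0 ↮_ℍ e` is at most the
near sum (classes `2^j ≤ ‖v‖∞ < 2^{j+1}` with `2^j < 8L`: both masses times the two-arm indicator at
scale `min(2^j, L)`) plus the far sum (`8L ≤ 2^j`: one mass times `|W_L|` times the two-arm indicator
at scale `2^{j-1}`). -/
theorem stub_pairCount :
    ∀ e ∈ ({Pi.single 1 1, Pi.single 1 (-1), Pi.single 2 1, Pi.single 2 (-1)} : Finset (Site 3)), ∀ L : ℕ, 1 ≤ L → ∀ ω : BondConfig (Site 3),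
      (∑ w ∈ ((box 3 L).image fun y : Site 3 => y + Pi.single 0 (((2 * L : ℕ)) : ℤ)), ∑' v : {v : Site 3 // 1 ≤ v 0}, (openConnIn {x : Site 3 | 0 ≤ x 0} 0 (v : Site 3) ∩ openConnIn {x : Site 3 | 0 ≤ x 0} e ((v : Site 3) + w) ∩ (openConnIn {x : Site 3 | 0 ≤ x 0} 0 e)ᶜ).indicator (fun _ => (1 : ℝ≥0∞)) ω)
        ≤ (∑ j ∈ Finset.range (8 * L), if 2 ^ j < 8 * L then (((↑(box 3 (2 ^ (j + 1))) : Set (Site 3)) ∩ {y : Site 3 | ω ∈ openConnIn {x : Site 3 | 0 ≤ x 0} 0 y}).ncard : ℝ≥0∞) * (((↑(box 3 (20 * L)) : Set (Site 3)) ∩ {y : Site 3 | ω ∈ openConnIn {x : Site 3 | 0 ≤ x 0} e (e + y)}).ncard : ℝ≥0∞) * ({ω | ∃ y : Site 3, (∃ i : Fin 3, ((min (2 ^ j) L : ℕ) : ℤ) ≤ |y i|) ∧ ω ∈ openConnIn {x : Site 3 | 0 ≤ x 0} 0 y} ∩ {ω | ∃ y : Site 3, (∃ i : Fin 3, ((min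 (2 ^ j) L : ℕ) : ℤ) ≤ |y i - e i|) ∧ ω ∈ openConnIn {x : Site 3 | 0 ≤ x 0} e y} ∩ (openConnIn {x : Site 3 | 0 ≤ x 0} 0 e)ᶜ).indicator (fun _ => (1 : ℝ≥0∞)) ω else 0)
          + (∑' j : ℕ, if 8 * L ≤ 2 ^ j then (((↑(box 3 (2 ^ (j + 1))) : Set (Site 3)) ∩ {y : Site 3 | ω ∈ openConnIn {x : Site 3 | 0 ≤ x 0} 0 y}).ncard : ℝ≥0∞) * ((((box 3 L).image fun y : Site 3 => y + Pi.single 0 (((2 * L : ℕ)) : ℤ))).card : ℝ≥0∞) * ({ω | ∃ y : Site 3, (∃ i : Fin 3, ((2 ^ (j - 1) : ℕ) : ℤ) ≤ |y i|) ∧ ω ∈ openConnIn {x : Site 3 | 0 ≤ x 0} 0 y} ∩ {ω | ∃ y : Site 3, (∃ i : Fin 3, ((2 ^ (j - 1) : ℕ) : ℤ) ≤ |y i - e i|) ∧ ω ∈ openConnIn {x : Site 3 | 0 ≤ x 0} e y} ∩ (openConnIn {x : Site 3 | 0 ≤ x 0} 0 e)ᶜ).indicator (fun _ => (1 : ℝ≥0∞))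 ω else 0) := by
  intro e he L hL ω
  obtain ⟨he0, he1⟩ := nbrs_spec he
  obtain ⟨g, hg⟩ : ∃ g : Site 3 → Site 3 → ℝ≥0∞, ∀ v w, g v w =
      if 1 ≤ v 0 then (𝑬⟦e, v, w⟧).indicator (fun _ => (1 : ℝ≥0∞)) ω else 0 := ⟨_, fun _ _ => rfl⟩
  -- Step 1: pass from `v : ℍ₊` to all `v : ℤ³` (the constraint is built into `g`).
  have h1 : ∀ w : Site 3,
      ∑' v : {v : Site 3 // 1 ≤ v 0}, (𝑬⟦e, (v : Site 3), w⟧).indicator (fun _ => (1 : ℝ≥0∞)) ω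
        ≤ ∑' v : Site 3, g v w := by
    intro w
    calc ∑' v : {v : Site 3 // 1 ≤ v 0}, (𝑬⟦e, (v : Site 3), w⟧).indicator (fun _ => (1 : ℝ≥0∞)) ω
        = ∑' v : {v : Site 3 // 1 ≤ v 0}, g (v : Site 3) w :=
          tsum_congr fun v => by rw [hg, if_pos v.2]
      _ ≤ ∑' v : Site 3, g v w :=
          ENNReal.tsum_comp_le_tsum_of_injective Subtype.val_injective fun v => g v w
  -- Step 2: swap the sums and insert the dyadic class of `v`.
  have h2 : ∑ w ∈ 𝑾⟦L⟧, ∑' v : Site 3, g v w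
      = ∑' j : ℕ, ∑' v : Site 3, (if j = Nat.log 2 𝑵⟦v⟧ then ∑ w ∈ 𝑾⟦L⟧, g v w else 0) := by
    rw [← Summable.tsum_finsetSum (f := fun w v => g v w) fun _ _ => ENNReal.summable]
    refine Eq.trans (tsum_congr fun v => ?_) ENNReal.tsum_comm
    rw [tsum_eq_single (Nat.log 2 𝑵⟦v⟧) fun j hj => if_neg hj, if_pos rfl]
  -- Step 3: the class bounds.
  have h3 : ∀ j : ℕ, ∑' v : Site 3, (if j = Nat.log 2 𝑵⟦v⟧ then ∑ w ∈ 𝑾⟦L⟧, g v w else 0)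
      ≤ (if 2 ^ j < 8 * L then ((𝑪₀⟦ω, 2 ^ (j + 1)⟧).ncard : ℝ≥0∞) * ((𝑪⟦ω, e, 20 * L⟧).ncard : ℝ≥0∞) *
            (𝑨⟦e, min (2 ^ j) L⟧).indicator (fun _ => (1 : ℝ≥0∞)) ω else 0) +
          (if 8 * L ≤ 2 ^ j then ((𝑪₀⟦ω, 2 ^ (j + 1)⟧).ncard : ℝ≥0∞) * ((𝑾⟦L⟧).card : ℝ≥0∞) *
            (𝑨⟦e, 2 ^ (j - 1)⟧).indicator (fun _ => (1 : ℝ≥0∞)) ω else 0) := by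
    intro j
    by_cases hj : 2 ^ j < 8 * L
    · rw [if_pos hj, if_neg (not_le.2 hj), add_zero]
      exact near_class_le he0 he1 hg hj
    · rw [if_neg hj, if_pos (not_lt.1 hj), zero_add]
      exact far_class_le he1 hg hL (not_lt.1 hj)
  -- Step 4: assemble; the near classes have `j < 2 ^ j < 8L`.
  refine ((Finset.sum_le_sum fun w _ => h1 w).trans_eq h2).trans ((ENNReal.tsum_le_tsum h3).trans_eq ?_)
  rw [ENNReal.tsum_add]
  congr 1
  exact tsum_eq_sum fun j hj => if_neg fun h => hj (Finset.mem_range.2 (Nat.lt_two_pow_self.trans h))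

end Summit.CriticalPhenomena.PercolationContinuityZ3.Theorems.FloorRusso

end
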